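import Literature.InformationTheory.QuantumCodes.QuantumExpanderCriticalGenerators
import HarnessLib

/-!
# Quantum expander codes: the syndrome decrease of a critical generator's flip set
# (Leverrier–Tillich–Zémor 2015 App. B eq. (partial) / Fawzi–Grospellier–Leverrier 2018 Lemma 24, first
# display) — PROOF

Topic `Literature/InformationTheory/QuantumCodes` (venture QEC; small-set-flip analysis, step 2 of 4).
Sources: LTZ15 = arXiv:1504.00822v1, App. B "Proof of Lemma 8", eq. (partial) and the regions
`S_{ab̄}, S_{āb}, S_a, S_b` (p0013 L55-90); FGL18 = arXiv:1711.08351v2, Lemma 24 proof, first display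
(§7.1, p0018 L72-76). Vocabulary of `QuantumExpanderCriticalGenerators.lean`.

* `expanderHX_mulVec_apply` — the check `αβ` reads `Σ_{a' ∼ β} e(αa') + Σ_{b' ∼ α} e(b'β)`;
* `expanderHX_mulVec_flipVec_critFlip` — the syndrome of the flip set `F = x_a ⊎ x_b`;
* `expanderHX_mulVec_apply_of_isCritical` — on the clean grid of a critical generator the check `αβ` reads
  `e(αa) + e(bβ)` (LTZ15's remark after Def. 6: value `0` on `Γ(x_a)∩Γ(x_b)` and `Γ(x̄_a)∩Γ(x̄_b)`, `1` on
  the mixed regions);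
* `syndromeDecrease_critFlip_ge` — **the decrease inequality, PROVED**: flipping `F` lowers `|σ_X|` by at
  least `|x_a||x̄_b| + |x̄_a||x_b| − |x_a||χ_b| − |χ_a||x_b|` (`1 → 0` on `Γ(x_a)∩Γ(x̄_b)`, `Γ(x̄_a)∩Γ(x_b)`;
  possibly `0 → 1` only on `Γ(x_a)∩Γ(χ_b)`, `Γ(χ_a)∩Γ(x_b)`; unchanged elsewhere).
-/

namespace Literature.InformationTheory.QuantumCodes

namespace QuantumExpander

open Finset Matrix

variable {A B : Type*} [Fintype A] [Fintype B] [DecidableEq A] [DecidableEq B]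

/-- In `𝔽₂` a non-zero element is `1`. [folklore] -/
private theorem zmod2_eq_one_of_ne_zero {z : ZMod 2} (h : z ≠ 0) : z = 1 := by
  revert z; decide

section SyndromeDecrease

/-- Entry formula for the `σ_X`-syndrome: the check `αβ` sums the qubits `αa'` with `a' ∼ β` and the qubits
`b'β` with `b' ∼ α`. [cite: LeverrierTillichZemor2015, §2 (Γ(αa), Γ(bβ); arXiv v1 p0005 L55-66)] -/
theorem expanderHX_mulVec_apply (H : Matrix B A (ZMod 2)) (v : (A × A) ⊕ (B × B) → ZMod 2) (α : A) (β : B) :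
    (expanderHX H *ᵥ v) (α, β)
      = ∑ a', H β a' * v (Sum.inl (α, a')) + ∑ b', H b' α * v (Sum.inr (b', β)) := by
  simp only [Matrix.mulVec, dotProduct, Fintype.sum_sum_type, expanderHX]
  congr 1
  · rw [Fintype.sum_prod_type]
    simp only [HypergraphProduct.zMatrix_apply_inl, Matrix.transpose_apply]
    rw [Finset.sum_eq_single α]
    · simp
    · intro α' _ hne
      simp [Ne.symm hne]
    · intro h; exact absurd (Finset.mem_univ α) h
  · rw [Fintype.sum_prod_type_right]
    simp only [HypergraphProduct.zMatrix_apply_inr]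
    rw [Finset.sum_eq_single β]
    · simp
    · intro β' _ hne
      simp [Ne.symm hne]
    · intro h; exact absurd (Finset.mem_univ β) h

/-- The syndrome of the flip set `F = x_a ⊎ x_b`: the check `αβ` is hit once by `x_a` iff `α ∈ X_a` and
`β ∼ a`, and once by `x_b` iff `β ∈ Y_b` and `α ∼ b`.
[cite: FawziGrospellierLeverrier2018, Lemma 24 proof (effect of flipping x_A ⊎ x_B; arXiv v2 p0018 L72-80)] [cite: LeverrierTillichZemor2015, App. B (∂, the regions S; arXiv v1 p0013)] -/
theorem expanderHX_mulVec_flipVec_critFlip (H : Matrix B A (ZMod 2)) (e : (A × A) ⊕ (B × B) → ZMod 2)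
    (b : B) (a : A) (Χa : Finset A) (Χb : Finset B) (α : A) (β : B) :
    (expanderHX H *ᵥ flipVec (critFlip H e b a Χa Χb)) (α, β)
      = (if α ∈ critX H e b a Χa then H β a else 0) + (if β ∈ critY H e b a Χb then H b α else 0) := by
  classical
  rw [expanderHX_mulVec_apply]
  congr 1
  · have hval : ∀ a', flipVec (critFlip H e b a Χa Χb) (Sum.inl (α, a'))
        = if a' = a ∧ α ∈ critX H e b a Χa then 1 else 0 := by
      intro a'
      simp only [flipVec, inl_mem_critFlip]
    simp_rw [hval]
    rw [Finset.sum_eq_single a]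
    · by_cases h : α ∈ critX H e b a Χa <;> simp [h]
    · intro a' _ hne; simp [hne]
    · intro h; exact absurd (Finset.mem_univ a) h
  · have hval : ∀ b', flipVec (critFlip H e b a Χa Χb) (Sum.inr (b', β))
        = if b' = b ∧ β ∈ critY H e b a Χb then 1 else 0 := by
      intro b'
      simp only [flipVec, inr_mem_critFlip]
    simp_rw [hval]
    rw [Finset.sum_eq_single b]
    · by_cases h : β ∈ critY H e b a Χb <;> simp [h]
    · intro b' _ hne; simp [hne]
    · intro h; exact absurd (Finset.mem_univ b) h

/-- The syndrome on the CLEAN GRID of a critical generator: for `α ∈ Γ(b) ∖ Χa`, `β ∈ Γ(a) ∖ Χb` the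
check `αβ` reads `e(αa) + e(bβ)` (it sees no other error qubit).
[cite: LeverrierTillichZemor2015, Def. 6 remark (syndrome 0 on Γ(x_a)∩Γ(x_b), Γ(x̄_a)∩Γ(x̄_b), 1 on the mixed regions; arXiv v1 p0008 L82-86)] -/
theorem expanderHX_mulVec_apply_of_isCritical {H : Matrix B A (ZMod 2)} {dA dB : ℕ} {δA δB : ℝ}
    {e : (A × A) ⊕ (B × B) → ZMod 2} {b : B} {a : A} {Χa : Finset A} {Χb : Finset B}
    (hc : IsCritical H dA dB δA δB (supp e) b a Χa Χb) {α : A} (hα : α ∈ nbrs Hᵀ b \ Χa) {β : B}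
    (hβ : β ∈ nbrs H a \ Χb) :
    (expanderHX H *ᵥ e) (α, β) = e (Sum.inl (α, a)) + e (Sum.inr (b, β)) := by
  classical
  have hcl := hc.clean α hα β hβ
  have hβa : H β a = 1 := zmod2_eq_one_of_ne_zero (mem_nbrs.1 (Finset.mem_sdiff.1 hβ).1)
  have hbα : H b α = 1 := by
    have := mem_nbrs.1 (Finset.mem_sdiff.1 hα).1
    rw [Matrix.transpose_apply] at this
    exact zmod2_eq_one_of_ne_zero this
  rw [expanderHX_mulVec_apply]
  congr 1
  · rw [Finset.sum_eq_single a]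
    · rw [hβa, one_mul]
    · intro a' _ hne
      by_cases hH : H β a' = 0
      · rw [hH, zero_mul]
      · have he : e (Sum.inl (α, a')) = 0 := by
          by_contra hne'
          exact hne (hcl.1 a' hH (by simpa [supp] using hne'))
        rw [he, mul_zero]
    · intro h; exact absurd (Finset.mem_univ a) h
  · rw [Finset.sum_eq_single b]
    · rw [hbα, one_mul]
    · intro b' _ hne
      by_cases hH : H b' α = 0
      · rw [hH, zero_mul]
      · have he : e (Sum.inr (b', β)) = 0 := by
          by_contra hne'
          exact hne (hcl.2 b' hH (by simpa [supp] using hne'))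
        rw [he, mul_zero]
    · intro h; exact absurd (Finset.mem_univ b) h

/-- **The syndrome-decrease inequality of a critical generator** (LTZ15 eq. (partial) / FGL18 Lemma 24,
first display): flipping `F = x_a ⊎ x_b` lowers the syndrome weight by at least
`|x_a||x̄_b| + |x̄_a||x_b| − |x_a||χ_b| − |χ_a||x_b|` — the checks in `Γ(x_a) ∩ Γ(x̄_b)` and
`Γ(x̄_a) ∩ Γ(x_b)` go from `1` to `0`, only those in `Γ(x_a) ∩ Γ(χ_b)` and `Γ(χ_a) ∩ Γ(x_b)` may go from `0`
to `1`, all others keep their value. Here `|x̄_a| = Δ_B − |χ_a| − |x_a|`, `|x̄_b| = Δ_A − |χ_b| − |x_b|`.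
[cite: LeverrierTillichZemor2015, App. B eq. (partial) (arXiv v1 p0013 L70-90)] [cite: FawziGrospellierLeverrier2018, Lemma 24 proof (arXiv v2 p0018 L72-76)] -/
theorem syndromeDecrease_critFlip_ge {H : Matrix B A (ZMod 2)} {dA dB : ℕ} {δA δB : ℝ}
    (hreg : IsBiregular H dA dB) {e : (A × A) ⊕ (B × B) → ZMod 2} {b : B} {a : A} {Χa : Finset A}
    {Χb : Finset B} (hc : IsCritical H dA dB δA δB (supp e) b a Χa Χb) :
    ((critX H e b a Χa).card : ℤ) * ((dA : ℤ) - Χb.card - (critY H e b a Χb).card)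
        + ((dB : ℤ) - Χa.card - (critX H e b a Χa).card) * (critY H e b a Χb).card
        - (critX H e b a Χa).card * Χb.card - Χa.card * (critY H e b a Χb).card
      ≤ syndromeDecrease (expanderHX H) (expanderHX H *ᵥ e) (critFlip H e b a Χa Χb) := by
  classical
  -- names
  set Xa := critX H e b a Χa with hXa
  set Yb := critY H e b a Χb with hYb
  set Xbar := (nbrs Hᵀ b \ Χa).filter fun α => e (Sum.inl (α, a)) = 0 with hXbar
  set Ybar := (nbrs H a \ Χb).filter fun β => e (Sum.inr (b, β)) = 0 with hYbar
  set F := critFlip H e b a Χa Χb with hF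
  set σ := expanderHX H *ᵥ e with hσ
  set τ := expanderHX H *ᵥ flipVec F with hτ
  -- cardinalities of the complements
  have hXbar' : (nbrs Hᵀ b \ Χa).filter (fun α => ¬ (e (Sum.inl (α, a)) ≠ 0)) = Xbar := by
    rw [hXbar]; exact Finset.filter_congr (fun α _ => by rw [not_not])
  have hYbar' : (nbrs H a \ Χb).filter (fun β => ¬ (e (Sum.inr (b, β)) ≠ 0)) = Ybar := by
    rw [hYbar]; exact Finset.filter_congr (fun β _ => by rw [not_not])
  have hXsplit : Xa.card + Xbar.card = (nbrs Hᵀ b \ Χa).card := by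
    rw [← hXbar', hXa, critX]
    exact Finset.card_filter_add_card_filter_not _
  have hYsplit : Yb.card + Ybar.card = (nbrs H a \ Χb).card := by
    rw [← hYbar', hYb, critY]
    exact Finset.card_filter_add_card_filter_not _
  have hrows : (nbrs Hᵀ b \ Χa).card = dB - Χa.card := by
    rw [Finset.card_sdiff_of_subset hc.Χa_subset, card_nbrs_transpose_eq H hreg b]
  have hcols : (nbrs H a \ Χb).card = dA - Χb.card := by
    rw [Finset.card_sdiff_of_subset hc.Χb_subset, card_nbrs_eq H hreg a]
  have hΧa_le : Χa.card ≤ dB := by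
    have := Finset.card_le_card hc.Χa_subset; rwa [card_nbrs_transpose_eq H hreg b] at this
  have hΧb_le : Χb.card ≤ dA := by
    have := Finset.card_le_card hc.Χb_subset; rwa [card_nbrs_eq H hreg a] at this
  have hXbar_card : (Xbar.card : ℤ) = (dB : ℤ) - Χa.card - Xa.card := by
    have h1 : (Xa.card : ℤ) + Xbar.card = ((dB - Χa.card : ℕ) : ℤ) := by
      rw [← hrows, ← hXsplit]; push_cast; ring
    rw [Nat.cast_sub hΧa_le] at h1
    linarith
  have hYbar_card : (Ybar.card : ℤ) = (dA : ℤ) - Χb.card - Yb.card := by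
    have h1 : (Yb.card : ℤ) + Ybar.card = ((dA - Χb.card : ℕ) : ℤ) := by
      rw [← hcols, ← hYsplit]; push_cast; ring
    rw [Nat.cast_sub hΧb_le] at h1
    linarith
  -- membership facts
  have hXa_mem : ∀ {α}, α ∈ Xa → α ∈ nbrs Hᵀ b \ Χa ∧ e (Sum.inl (α, a)) ≠ 0 := by
    intro α h
    rw [hXa, critX, Finset.mem_filter] at h
    exact h
  have hXbar_mem : ∀ {α}, α ∈ Xbar → α ∈ nbrs Hᵀ b \ Χa ∧ e (Sum.inl (α, a)) = 0 := by
    intro α h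
    rw [hXbar, Finset.mem_filter] at h
    exact h
  have hYb_mem : ∀ {β}, β ∈ Yb → β ∈ nbrs H a \ Χb ∧ e (Sum.inr (b, β)) ≠ 0 := by
    intro β h
    rw [hYb, critY, Finset.mem_filter] at h
    exact h
  have hYbar_mem : ∀ {β}, β ∈ Ybar → β ∈ nbrs H a \ Χb ∧ e (Sum.inr (b, β)) = 0 := by
    intro β h
    rw [hYbar, Finset.mem_filter] at h
    exact h
  have hrow_of : ∀ {α}, α ∈ nbrs Hᵀ b \ Χa → H b α ≠ 0 := by
    intro α h
    have := mem_nbrs.1 (Finset.mem_sdiff.1 h).1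
    rwa [Matrix.transpose_apply] at this
  have hcol_of : ∀ {β}, β ∈ nbrs H a \ Χb → H β a ≠ 0 := fun h => mem_nbrs.1 (Finset.mem_sdiff.1 h).1
  -- the three region types
  set P1 := (Xa ×ˢ Ybar) ∪ (Xbar ×ˢ Yb) with hP1
  set P2 := (Xa ×ˢ Χb) ∪ (Χa ×ˢ Yb) with hP2
  -- the flip syndrome entries
  have hτ_apply : ∀ α β, τ (α, β)
      = (if α ∈ Xa then H β a else 0) + (if β ∈ Yb then H b α else 0) := by
    intro α β
    rw [hτ, hF, hXa, hYb]
    exact expanderHX_mulVec_flipVec_critFlip H e b a Χa Χb α β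
  -- (B1) on `P1` the syndrome goes from `1` to `0`
  have hP1_prop : ∀ c ∈ P1, σ c ≠ 0 ∧ (σ + τ) c = 0 := by
    rintro ⟨α, β⟩ hcmem
    rw [hP1, Finset.mem_union, Finset.mem_product, Finset.mem_product] at hcmem
    rcases hcmem with ⟨hαX, hβY⟩ | ⟨hαX, hβY⟩
    · obtain ⟨hα, heα⟩ := hXa_mem hαX
      obtain ⟨hβ, heβ⟩ := hYbar_mem hβY
      have hσc : σ (α, β) = e (Sum.inl (α, a)) := by
        rw [hσ, expanderHX_mulVec_apply_of_isCritical hc hα hβ, heβ, add_zero]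
      have hτc : τ (α, β) = 1 := by
        rw [hτ_apply, if_pos hαX, if_neg, add_zero, zmod2_eq_one_of_ne_zero (hcol_of hβ)]
        intro hβYb
        exact (hYb_mem hβYb).2 heβ
      refine ⟨by rw [hσc]; exact heα, ?_⟩
      rw [Pi.add_apply, hσc, hτc, zmod2_eq_one_of_ne_zero heα]
      decide
    · obtain ⟨hα, heα⟩ := hXbar_mem hαX
      obtain ⟨hβ, heβ⟩ := hYb_mem hβY
      have hσc : σ (α, β) = e (Sum.inr (b, β)) := by
        rw [hσ, expanderHX_mulVec_apply_of_isCritical hc hα hβ, heα, zero_add]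
      have hτc : τ (α, β) = 1 := by
        rw [hτ_apply, if_neg, if_pos hβY, zero_add, zmod2_eq_one_of_ne_zero (hrow_of hα)]
        intro hαXa
        exact (hXa_mem hαXa).2 heα
      refine ⟨by rw [hσc]; exact heβ, ?_⟩
      rw [Pi.add_apply, hσc, hτc, zmod2_eq_one_of_ne_zero heβ]
      decide
  -- (B2) off `P1 ∪ P2` the syndrome is unchanged
  have hrest : ∀ c, c ∉ P1 → c ∉ P2 → (σ + τ) c = σ c := by
    rintro ⟨α, β⟩ h1 h2
    rw [hP1, Finset.mem_union, Finset.mem_product, Finset.mem_product, not_or] at h1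
    rw [hP2, Finset.mem_union, Finset.mem_product, Finset.mem_product, not_or] at h2
    rw [Pi.add_apply, hτ_apply]
    by_cases hαX : α ∈ Xa
    · -- then `β ∈ Γ(a)`-cases
      rw [if_pos hαX]
      by_cases hβa : H β a = 0
      · rw [hβa, zero_add]
        by_cases hβY : β ∈ Yb
        · exact absurd hβa (hcol_of (hYb_mem hβY).1)
        · rw [if_neg hβY, add_zero]
      · -- `β ∈ Γ(a)`: `β ∈ Yb ∪ Ybar ∪ Χb`
        have hβY : β ∈ Yb := by
          by_contra hβY
          by_cases hβΧ : β ∈ Χb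
          · exact h2.1 ⟨hαX, hβΧ⟩
          · have hβsd : β ∈ nbrs H a \ Χb := Finset.mem_sdiff.2 ⟨mem_nbrs.2 hβa, hβΧ⟩
            have hβYbar : β ∈ Ybar := by
              rw [hYbar, Finset.mem_filter]
              refine ⟨hβsd, ?_⟩
              by_contra hne
              exact hβY (by rw [hYb, critY, Finset.mem_filter]; exact ⟨hβsd, hne⟩)
            exact h1.1 ⟨hαX, hβYbar⟩
        rw [if_pos hβY, zmod2_eq_one_of_ne_zero hβa,
          zmod2_eq_one_of_ne_zero (hrow_of (hXa_mem hαX).1)]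
        have : (1 : ZMod 2) + 1 = 0 := by decide
        rw [this, add_zero]
    · rw [if_neg hαX, zero_add]
      by_cases hβY : β ∈ Yb
      · rw [if_pos hβY]
        by_cases hbα : H b α = 0
        · rw [hbα, add_zero]
        · -- `α ∈ Γ(b)`: `α ∈ Xa ∪ Xbar ∪ Χa`
          exfalso
          by_cases hαΧ : α ∈ Χa
          · exact h2.2 ⟨hαΧ, hβY⟩
          · have hαsd : α ∈ nbrs Hᵀ b \ Χa :=
              Finset.mem_sdiff.2 ⟨mem_nbrs.2 (by rwa [Matrix.transpose_apply]), hαΧ⟩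
            have hαXbar : α ∈ Xbar := by
              rw [hXbar, Finset.mem_filter]
              refine ⟨hαsd, ?_⟩
              by_contra hne
              exact hαX (by rw [hXa, critX, Finset.mem_filter]; exact ⟨hαsd, hne⟩)
            exact h1.2 ⟨hαXbar, hβY⟩
      · rw [if_neg hβY, add_zero]
  -- (B3) counting
  have hdec : syndromeDecrease (expanderHX H) σ F = (hammingNorm σ : ℤ) - hammingNorm (σ + τ) := by
    rw [syndromeDecrease]
  rw [hdec]
  have hnormσ : (hammingNorm σ : ℤ) = ∑ c, (if σ c ≠ 0 then 1 else 0 : ℤ) := by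
    simp only [hammingNorm]
    rw [Finset.card_filter]
    push_cast
    rfl
  have hnormσ' : (hammingNorm (σ + τ) : ℤ) = ∑ c, (if (σ + τ) c ≠ 0 then 1 else 0 : ℤ) := by
    simp only [hammingNorm]
    rw [Finset.card_filter]
    push_cast
    rfl
  have hpt : ∀ c, (if c ∈ P1 then (1 : ℤ) else 0) - (if c ∈ P2 then 1 else 0)
      ≤ (if σ c ≠ 0 then (1 : ℤ) else 0) - (if (σ + τ) c ≠ 0 then 1 else 0) := by
    intro c
    have hA : (0 : ℤ) ≤ (if σ c ≠ 0 then (1 : ℤ) else 0) := by split_ifs <;> norm_num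
    have hB : (if (σ + τ) c ≠ 0 then (1 : ℤ) else 0) ≤ 1 := by split_ifs <;> norm_num
    have hC : (0 : ℤ) ≤ (if c ∈ P2 then (1 : ℤ) else 0) := by split_ifs <;> norm_num
    by_cases h1 : c ∈ P1
    · obtain ⟨hs, hs'⟩ := hP1_prop c h1
      have e1 : (if σ c ≠ 0 then (1 : ℤ) else 0) = 1 := if_pos hs
      have e2 : (if (σ + τ) c ≠ 0 then (1 : ℤ) else 0) = 0 := by rw [hs']; simp
      rw [e1, e2, if_pos h1]
      linarith
    · rw [if_neg h1]
      by_cases h2 : c ∈ P2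
      · rw [if_pos h2]; linarith
      · rw [if_neg h2, hrest c h1 h2]; simp
  have hsum := Finset.sum_le_sum fun c (_ : c ∈ (Finset.univ : Finset (A × B))) => hpt c
  rw [Finset.sum_sub_distrib, Finset.sum_sub_distrib, ← hnormσ, ← hnormσ'] at hsum
  have hP1card : ∑ c : A × B, (if c ∈ P1 then (1 : ℤ) else 0) = P1.card := by
    rw [Finset.sum_boole, Finset.filter_mem_eq_inter, Finset.univ_inter]
  have hP2card : ∑ c : A × B, (if c ∈ P2 then (1 : ℤ) else 0) = P2.card := by
    rw [Finset.sum_boole, Finset.filter_mem_eq_inter, Finset.univ_inter]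
  rw [hP1card, hP2card] at hsum
  -- `|P1| = |Xa||Ybar| + |Xbar||Yb|`, `|P2| ≤ |Xa||Χb| + |Χa||Yb|`
  have hdisjX : Disjoint Xa Xbar := by
    rw [Finset.disjoint_left]
    intro α h1 h2
    exact (hXa_mem h1).2 (hXbar_mem h2).2
  have hP1eq : (P1.card : ℤ) = Xa.card * Ybar.card + Xbar.card * Yb.card := by
    rw [hP1, Finset.card_union_of_disjoint, Finset.card_product, Finset.card_product]
    · push_cast; ring
    · rw [Finset.disjoint_left]
      rintro ⟨α, β⟩ h h'
      rw [Finset.mem_product] at h h'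
      exact Finset.disjoint_left.1 hdisjX h.1 h'.1
  have hP2le : (P2.card : ℤ) ≤ Xa.card * Χb.card + Χa.card * Yb.card := by
    have := Finset.card_union_le (Xa ×ˢ Χb) (Χa ×ˢ Yb)
    rw [Finset.card_product, Finset.card_product] at this
    rw [hP2]; exact_mod_cast this
  rw [hP1eq, hXbar_card, hYbar_card] at hsum
  linarith

end SyndromeDecrease

end QuantumExpander

end Literature.InformationTheory.QuantumCodes
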